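import Summits.HodgeConjecture.CorCM.MultiFieldWeilStabiliserTransfer
import HarnessLib

/-!
# MULTI-FIELD WEIL ENGINE — TWIN UNITS: the defect law for tuple sets with a TWIN PAIR of slots (two slots reading ONE frame, diagonal tuples — two CM types of ONE field),
# stabiliser-transitive ACROSS units (census level)

Cell `pub-hodgecm2` (COR-CM), seat b30 gen 37 (2026-08-25); count-neutral own lane MULTI-FIELD WEIL ENGINE (stem `MultiFieldWeil*`), census level (abstract tuple sets
`R ⊆ ∏_m Sym(n_m)` of `Census/MultiFieldWeil*`), sequel of `CorCM/MultiFieldWeilStabiliserTransfer.lean` (V1).  Theorems only; no definition, no named fact, no `sorry`, no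
`decide`.  HONEST FRAMING: pure finite combinatorics; `HC_CM` is NOT touched.

THE POINT.  V1's transfer needs STABILISER-TRANSITIVITY for every pair of slots `m₀ ≠ m`: some tuple trivial at `m₀` moves `m`.  Two slots carrying TWO TYPES OF ONE FIELD
`K = k·F⁺` (the simple CM threefolds `B`, `B^σ` of `CorCM/MultiFieldWeilIsolatedPairBlock.lean`) read ONE frame, so every realised tuple is DIAGONAL on them (`π_{m₂} = π_{m₁}`)
and no tuple trivial at `m₁` moves `m₂`.  Here the slots are grouped into UNITS (a map `U : Fin r → Fin r`; a unit = a fibre of `U`), stabiliser-transitivity is asked only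
ACROSS units («some tuple trivial on the whole unit of `m₀` moves `m`»), and:
* §1 **`signed_transfer_units`** — the signed equations at `R` imply the signed equations at every tuple of the UNIT-WISE product `R⁺ = {π' : ∀ unit, π'|_unit = π|_unit for
  some π ∈ R}` (V1's averaging over the cosets `{π ∈ R : π|_{unit} = π'|_{unit}}`; the fibres of `U` are summed with `Finset.sum_fiberwise`);
* §2 **`const_of_signed_twin`** — THE TWIN UNIT: two slots `m₁ ≠ m₂` of one size `≥ 3` with SINGLETON position sets `{p₁}`, `{p₂}`, `p₂ ≠ p₁` (read through the size
  identification), a set of tuples DIAGONAL on them whose `m₁`-components are `2`-TRANSITIVE: if `E_{m₁}(π) + E_{m₂}(π)` is constant on the set then both defects are constant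
  (`E_m(σ) = 2 d_m(σ⁻¹ p_m) − D_m`, so `d_{m₁}(b) + d_{m₂}(b′)` is constant on `b ≠ b′`; a third position separates);
* §3 **`exists_hasDefectsG_of_twinStabiliserTransitive`** — THE DEFECT LAW for `R` non-empty, closed, transitive on every slot, with ONE twin pair `(m₁, m₂)` as above, all
  slots of PRIME size with proper non-empty position sets, stabiliser-transitive across units: every configuration balanced under `R` obeys the defect law (transfer to `R⁺`;
  there every non-twin slot is moved ALONE by a tuple of prime order, so V1's prime tower `const_of_signed_primeTower` with the twin pair as the excluded set makes those defects
  constant; then §2 on `R⁺`; `exists_defects_of_const`).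
The realised-tuple reading (twin slots = two primitive types of one non-Galois sextic `k·F⁺`, whose diagonal image is `𝔖₃`, `2`-transitive; cross-unit stabiliser-transitivity
from «outside closures») and the geometric engine (`hodgeConjectureFor_biproduct_comp_of_defectLawG`, which needs only the single-slot Weil spaces) are the sequel: together they
remove «isolated» for third fields over `k` with a different closure in `CorCM/MultiFieldWeilTwoPerIsolatedField*`.
[cite: MoonenZarhin1995Duke, Thm. 2.4] [cite: Pohlmann1968, Thm 1] [cite: GaoUllmo2025, Thm 3.1] [cite: DixonMortimer1996, §1.6 and Thm. 1.6A; §2.1]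

## References
* [MoonenZarhin1995Duke] B. Moonen, Yu. Zarhin, Duke Math. J. 77 (1995), Thm. 2.4.  [Pohlmann1968] H. Pohlmann, Ann. of Math. 88 (1968), Thm 1.  [GaoUllmo2025] Z. Gao, E. Ullmo,
  J. Inst. Math. Jussieu 25 (2025), Thm 3.1.  [DixonMortimer1996] J. D. Dixon, B. Mortimer, *Permutation Groups*, GTM 163, §1.6, Thm. 1.6A, §2.1.
-/

noncomputable section

namespace Summit.HodgeConjecture.CorCM.MultiFieldWeil

open Finset
open Summit.HodgeConjecture.CorCM.Census.MultiFieldWeil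

open scoped Classical

section Model

variable {r : ℕ} {n : Fin r → ℕ} {R : Finset (PermsG n)} {P : ∀ m : Fin r, Finset (Fin (n m))}

/-! ## §1 The transfer across units -/

/-- **THE TRANSFER ACROSS UNITS.**  `R ⊆ ∏_m Sym(n_m)` non-empty, product-closed, transitive on every slot; slots grouped into units by `U`; STABILISER-TRANSITIVE ACROSS
UNITS: for `U m₀ ≠ U m` and positions `a, a'` of `m` some tuple of `R` is the identity on the whole unit of `m₀` and carries `a` to `a'` at `m`.  If the signed equations
`u + Σ_m Σ_a (±_{π_m a ∈ P_m} d_m a) = 0` hold at every `π ∈ R`, they hold at every tuple `π'` that agrees unit-wise with tuples of `R`. [cite: MoonenZarhin1995Duke, Thm. 2.4]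
[cite: GaoUllmo2025, Thm 3.1] -/
theorem signed_transfer_units (U : Fin r → Fin r) (hmul : ∀ π ∈ R, ∀ π' ∈ R, π * π' ∈ R) (hne : R.Nonempty)
    (htrans : ∀ (m : Fin r) (a a' : Fin (n m)), ∃ π ∈ R, π m a = a')
    (hstab : ∀ (m₀ m : Fin r), U m₀ ≠ U m → ∀ a a' : Fin (n m), ∃ ν ∈ R, (∀ m', U m' = U m₀ → ν m' = 1) ∧ ν m a = a')
    {u : ℤ} {d : ∀ m : Fin r, Fin (n m) → ℤ}
    (h : ∀ π ∈ R, u + ∑ m : Fin r, ∑ a : Fin (n m), (if π m a ∈ P m then d m a else -d m a) = 0)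
    (π' : PermsG n) (hπ' : ∀ m₀ : Fin r, ∃ π ∈ R, ∀ m, U m = U m₀ → π m = π' m) :
    u + ∑ m : Fin r, ∑ a : Fin (n m), (if π' m a ∈ P m then d m a else -d m a) = 0 := by
  -- notation: the signed slot sums and their averages
  set E : ∀ m : Fin r, Equiv.Perm (Fin (n m)) → ℤ := fun m σ => ∑ a : Fin (n m), (if σ a ∈ P m then d m a else -d m a) with hE
  set A : Fin r → ℚ := fun m => (2 * ((P m).card : ℚ) - n m) * (∑ a : Fin (n m), (d m a : ℚ)) / n m with hA
  have hEdef : ∀ (m : Fin r) (σ : Equiv.Perm (Fin (n m))), E m σ = ∑ a : Fin (n m), (if σ a ∈ P m then d m a else -d m a) := fun _ _ => rfl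
  -- (1) over all of `R`: `u + Σ_m A_m = 0`
  have hunifR : ∀ (m : Fin r) (a a' : Fin (n m)), (R.filter fun π => π m a ∈ P m).card = (R.filter fun π => π m a' ∈ P m).card := fun m =>
    card_filter_apply_mem_eq_of_movers R (fun a a' => by
      obtain ⟨ν, hν, hνa⟩ := htrans m a' a
      exact ⟨ν, fun π hπ => hmul π hπ ν hν, hνa⟩) (P m)
  have hsumR : ∀ m : Fin r, (∑ π ∈ R, (E m (π m) : ℚ)) = (R.card : ℚ) * A m := fun m => by
    simp only [hEdef, hA]
    exact sum_signed_slot_eq_card_mul R m (d m) (hunifR m)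
  have hRpos : (0 : ℚ) < R.card := by exact_mod_cast Finset.card_pos.2 hne
  have hstar : (u : ℚ) + ∑ m : Fin r, A m = 0 := by
    have h1 : ∑ π ∈ R, ((u : ℚ) + ∑ m : Fin r, (E m (π m) : ℚ)) = 0 := by
      refine Finset.sum_eq_zero fun π hπ => ?_
      have := h π hπ
      simp only [← hEdef] at this
      exact_mod_cast this
    rw [Finset.sum_add_distrib, Finset.sum_const, Finset.sum_comm, Finset.sum_congr rfl fun m _ => hsumR m, ← Finset.mul_sum, nsmul_eq_mul,
      ← mul_add] at h1
    exact (mul_eq_zero.1 h1).resolve_left hRpos.ne'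
  -- (2) over the coset `{π ∈ R | π = π' on the unit of m₀}`: `Σ_{unit of m₀} (E_m(π'_m) − A_m) = 0`
  have hunit : ∀ m₀ : Fin r, (∑ m ∈ univ.filter (fun m => U m = U m₀), ((E m (π' m) : ℚ) - A m)) = 0 := by
    intro m₀
    set C : Finset (PermsG n) := R.filter fun π => ∀ m, U m = U m₀ → π m = π' m with hC
    have hCR : C ⊆ R := Finset.filter_subset _ _
    have hCne : C.Nonempty := by
      obtain ⟨π, hπ, hπm⟩ := hπ' m₀
      exact ⟨π, Finset.mem_filter.2 ⟨hπ, hπm⟩⟩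
    have hCpos : (0 : ℚ) < C.card := by exact_mod_cast Finset.card_pos.2 hCne
    -- uniform on every slot of another unit (movers trivial on the unit of `m₀` preserve the coset)
    have hunifC : ∀ m : Fin r, U m ≠ U m₀ → ∀ a a' : Fin (n m), (C.filter fun π => π m a ∈ P m).card = (C.filter fun π => π m a' ∈ P m).card :=
      fun m hm => card_filter_apply_mem_eq_of_movers C (fun a a' => by
        obtain ⟨ν, hν, hν₀, hνa⟩ := hstab m₀ m (Ne.symm hm) a' a
        refine ⟨ν, fun π hπ => ?_, hνa⟩
        rw [hC, Finset.mem_filter] at hπ ⊢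
        exact ⟨hmul π hπ.1 ν hν, fun m' hm' => by rw [Pi.mul_apply, hν₀ m' hm', mul_one, hπ.2 m' hm']⟩) (P m)
    have hsumC : ∀ m : Fin r, U m ≠ U m₀ → (∑ π ∈ C, (E m (π m) : ℚ)) = (C.card : ℚ) * A m := fun m hm => by
      simp only [hEdef, hA]
      exact sum_signed_slot_eq_card_mul C m (d m) (hunifC m hm)
    have hsumC₀ : ∀ m : Fin r, U m = U m₀ → (∑ π ∈ C, (E m (π m) : ℚ)) = (C.card : ℚ) * E m (π' m) := fun m hm => by
      rw [Finset.sum_congr rfl fun π hπ => by rw [(Finset.mem_filter.1 hπ).2 m hm], Finset.sum_const, nsmul_eq_mul]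
    -- sum the signed equations over the coset
    have h1 : ∑ π ∈ C, ((u : ℚ) + ∑ m : Fin r, (E m (π m) : ℚ)) = 0 := by
      refine Finset.sum_eq_zero fun π hπ => ?_
      have := h π (hCR hπ)
      simp only [← hEdef] at this
      exact_mod_cast this
    have h3 : ∀ m : Fin r, (∑ π ∈ C, (E m (π m) : ℚ)) = (C.card : ℚ) * (if U m = U m₀ then (E m (π' m) : ℚ) else A m) := by
      intro m
      by_cases hm : U m = U m₀
      · rw [if_pos hm, hsumC₀ m hm]
      · rw [if_neg hm, hsumC m hm]
    rw [Finset.sum_add_distrib, Finset.sum_const, nsmul_eq_mul, Finset.sum_comm, Finset.sum_congr rfl fun m _ => h3 m, ← Finset.mul_sum, ← mul_add] at h1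
    have h4 : (u : ℚ) + ∑ m : Fin r, (if U m = U m₀ then (E m (π' m) : ℚ) else A m) = 0 := (mul_eq_zero.1 h1).resolve_left hCpos.ne'
    -- subtract `u + Σ_m A_m = 0`
    have h5 : ∑ m : Fin r, ((if U m = U m₀ then (E m (π' m) : ℚ) else A m) - A m) = 0 := by
      rw [Finset.sum_sub_distrib]; linarith [hstar, h4]
    rw [← Finset.sum_filter_add_sum_filter_not univ (fun m => U m = U m₀)] at h5
    have hzero : ∑ m ∈ univ.filter (fun m => ¬ U m = U m₀), ((if U m = U m₀ then (E m (π' m) : ℚ) else A m) - A m) = 0 :=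
      Finset.sum_eq_zero fun m hm => by rw [if_neg (Finset.mem_filter.1 hm).2, sub_self]
    rw [hzero, add_zero] at h5
    rw [← h5]
    exact Finset.sum_congr rfl fun m hm => by rw [if_pos (Finset.mem_filter.1 hm).2]
  -- (3) conclude by summing over the units
  have hfin : (u : ℚ) + ∑ m : Fin r, (E m (π' m) : ℚ) = 0 := by
    have hdiff : ∑ m : Fin r, ((E m (π' m) : ℚ) - A m) = 0 := by
      rw [← Finset.sum_fiberwise_of_maps_to (s := univ) (t := univ) (g := U) fun m _ => Finset.mem_univ (U m)]
      refine Finset.sum_eq_zero fun c _ => ?_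
      by_cases hc : ∃ m₀, U m₀ = c
      · obtain ⟨m₀, rfl⟩ := hc
        exact hunit m₀
      · exact Finset.sum_eq_zero fun m hm => absurd ⟨m, (Finset.mem_filter.1 hm).2⟩ hc
    rw [Finset.sum_sub_distrib, sub_eq_zero] at hdiff
    rw [hdiff]; exact hstar
  have : ((u + ∑ m : Fin r, E m (π' m) : ℤ) : ℚ) = 0 := by push_cast; exact hfin
  exact_mod_cast this

/-! ## §2 The twin unit -/

/-- The signed sum through a SINGLETON position set: `Σ_a (±_{σ a = p} f a) = 2 f(σ⁻¹ p) − Σ_a f a`. [folklore] -/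
theorem sum_ite_mem_singleton {k : ℕ} (σ : Equiv.Perm (Fin k)) (p : Fin k) (f : Fin k → ℤ) :
    (∑ a : Fin k, (if σ a ∈ ({p} : Finset (Fin k)) then f a else -f a)) = 2 * f (σ.symm p) - ∑ a : Fin k, f a := by
  rw [sum_ite_mem_eq_of_iff (Q := {σ.symm p}) (fun a => by rw [Finset.mem_singleton, Finset.mem_singleton, Equiv.eq_symm_apply]) f, Finset.sum_singleton]

/-- **THE TWIN UNIT.**  Slots `m₁ ≠ m₂` of one size `n ≥ 3` (identification `hn`), singleton position sets `P_{m₁} = {p₁}`, `P_{m₂} = {p₂}` with `p₂ ≠ p₁` under the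
identification; a set `D` of tuples DIAGONAL on the pair whose `m₁`-components are `2`-TRANSITIVE.  If `E_{m₁}(π_{m₁}) + E_{m₂}(π_{m₂})` is constant on `D`, then `d_{m₁}` and
`d_{m₂}` are constant: `E_m(σ) = 2 d_m(σ⁻¹ p_m) − D_m`, so `d_{m₁}(b) + d_{m₂}(b′)` does not depend on the pair `b ≠ b′`, and a third position separates.
[cite: DixonMortimer1996, §2.1] [cite: MoonenZarhin1995Duke, Thm. 2.4] -/
theorem const_of_signed_twin {m₁ m₂ : Fin r} (hn : n m₂ = n m₁) (h3 : 3 ≤ n m₁) {p₁ : Fin (n m₁)} {p₂ : Fin (n m₂)}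
    (hP₁ : P m₁ = {p₁}) (hP₂ : P m₂ = {p₂}) (hp : Fin.cast hn p₂ ≠ p₁) {D : Finset (PermsG n)}
    (hdiag : ∀ π ∈ D, ∀ a : Fin (n m₂), Fin.cast hn (π m₂ a) = π m₁ (Fin.cast hn a))
    (h2t : ∀ a a' b b' : Fin (n m₁), a ≠ a' → b ≠ b' → ∃ π ∈ D, π m₁ a = b ∧ π m₁ a' = b')
    {d : ∀ m : Fin r, Fin (n m) → ℤ} {w : ℤ}
    (h : ∀ π ∈ D, (∑ a : Fin (n m₁), (if π m₁ a ∈ P m₁ then d m₁ a else -d m₁ a)) + (∑ a : Fin (n m₂), (if π m₂ a ∈ P m₂ then d m₂ a else -d m₂ a)) = w) :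
    (∀ a b : Fin (n m₁), d m₁ a = d m₁ b) ∧ (∀ a b : Fin (n m₂), d m₂ a = d m₂ b) := by
  -- the second defect read on the positions of `m₁`
  set d₂ : Fin (n m₁) → ℤ := fun x => d m₂ (Fin.cast hn.symm x) with hd₂
  set w' : ℤ := w + (∑ a : Fin (n m₁), d m₁ a) + ∑ a : Fin (n m₂), d m₂ a with hw'
  have hcast : ∀ x : Fin (n m₁), Fin.cast hn (Fin.cast hn.symm x) = x := fun x => Fin.ext (by simp)
  have hcast' : ∀ a : Fin (n m₂), Fin.cast hn.symm (Fin.cast hn a) = a := fun a => Fin.ext (by simp)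
  -- the pair sums are constant on distinct pairs
  have hpair : ∀ b b' : Fin (n m₁), b ≠ b' → 2 * d m₁ b + 2 * d₂ b' = w' := by
    intro b b' hbb
    obtain ⟨π, hπ, hb, hb'⟩ := h2t b b' p₁ (Fin.cast hn p₂) hbb (Ne.symm hp)
    have hπ₁ : (π m₁).symm p₁ = b := by rw [Equiv.symm_apply_eq]; exact hb.symm
    have hπ₂ : (π m₂).symm p₂ = Fin.cast hn.symm b' := by
      rw [Equiv.symm_apply_eq]
      apply Fin.cast_injective hn
      rw [hdiag π hπ, hcast, hb']
    have := h π hπ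
    rw [hP₁, hP₂, sum_ite_mem_singleton, sum_ite_mem_singleton, hπ₁, hπ₂] at this
    simp only [hd₂, hw']
    linarith
  -- a third position separates
  have hthird : ∀ x y : Fin (n m₁), ∃ z : Fin (n m₁), z ≠ x ∧ z ≠ y := by
    intro x y
    by_contra hno
    push Not at hno
    have hsub : (Finset.univ : Finset (Fin (n m₁))) ⊆ {x, y} := fun z _ => by
      by_cases hz : z = x
      · simp [hz]
      · simp [hno z hz]
    have := Finset.card_le_card hsub
    rw [Finset.card_univ, Fintype.card_fin] at this
    exact absurd (this.trans (Finset.card_le_two)) (by omega)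
  have hd₂c : ∀ b' b'' : Fin (n m₁), d₂ b' = d₂ b'' := by
    intro b' b''
    obtain ⟨b, hb', hb''⟩ := hthird b' b''
    have h1 := hpair b b' hb'
    have h2 := hpair b b'' hb''
    linarith
  have hd₁c : ∀ b b' : Fin (n m₁), d m₁ b = d m₁ b' := by
    intro b b'
    obtain ⟨x, hx, hx'⟩ := hthird b b'
    have h1 := hpair b x (Ne.symm hx)
    have h2 := hpair b' x (Ne.symm hx')
    linarith
  refine ⟨hd₁c, fun a b => ?_⟩
  have ha : d m₂ a = d₂ (Fin.cast hn a) := by simp only [hd₂, hcast']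
  have hb : d m₂ b = d₂ (Fin.cast hn b) := by simp only [hd₂, hcast']
  rw [ha, hb, hd₂c]

/-! ## §3 The defect law with one twin pair -/

/-- **THE DEFECT LAW WITH A TWIN PAIR.**  `R ⊆ ∏_m Sym(n_m)` non-empty, closed under products and inverses, transitive on every slot, with a twin pair `m₁ ≠ m₂` (one size
`≥ 3`, DIAGONAL tuples, `2`-TRANSITIVE `m₁`-components, singleton position sets `{p₁} ≠ {p₂}` under the identification) and STABILISER-TRANSITIVE ACROSS UNITS (units: the
pair, and the single other slots); all slots of PRIME size with proper non-empty position sets (`c_m = n_m − 2|P_m|`).  Then every configuration balanced under `R` obeys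
the defect law.  (Transfer to the unit-wise product `R⁺`, §1; every non-twin slot is moved alone inside `R⁺` by a tuple of prime order, so V1's prime tower with the pair
excluded makes the non-twin defects constant; then the twin unit, §2; `exists_defects_of_const`.) [cite: MoonenZarhin1995Duke, Thm. 2.4]
[cite: DixonMortimer1996, §1.6 and Thm. 1.6A; §2.1] [cite: GaoUllmo2025, Thm 3.1] -/
theorem exists_hasDefectsG_of_twinStabiliserTransitive (hmul : ∀ π ∈ R, ∀ π' ∈ R, π * π' ∈ R) (hinv : ∀ π ∈ R, π⁻¹ ∈ R) (hne : R.Nonempty)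
    (htrans : ∀ (m : Fin r) (a a' : Fin (n m)), ∃ π ∈ R, π m a = a')
    {m₁ m₂ : Fin r} (hm : m₁ ≠ m₂) (hn : n m₂ = n m₁) (h3 : 3 ≤ n m₁)
    (hdiag : ∀ π ∈ R, ∀ a : Fin (n m₂), Fin.cast hn (π m₂ a) = π m₁ (Fin.cast hn a))
    (h2t : ∀ a a' b b' : Fin (n m₁), a ≠ a' → b ≠ b' → ∃ π ∈ R, π m₁ a = b ∧ π m₁ a' = b')
    (hstab : ∀ (m₀ m : Fin r), (if m₀ = m₂ then m₁ else m₀) ≠ (if m = m₂ then m₁ else m) → ∀ a a' : Fin (n m),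
      ∃ ν ∈ R, (∀ m', (if m' = m₂ then m₁ else m') = (if m₀ = m₂ then m₁ else m₀) → ν m' = 1) ∧ ν m a = a')
    (hpr : ∀ m, (n m).Prime) (hP0 : ∀ m, (P m).Nonempty) (hPn : ∀ m, (P m).card < n m)
    {p₁ : Fin (n m₁)} {p₂ : Fin (n m₂)} (hP₁ : P m₁ = {p₁}) (hP₂ : P m₂ = {p₂}) (hp : Fin.cast hn p₂ ≠ p₁)
    (c : Fin r → ℕ) (hc : ∀ m, ((c m : ℕ) : ℤ) = (n m : ℤ) - 2 * (P m).card)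
    {α : Type} (v : α → PtG n) (T : Finset α) (hT : ModelBalancedG P R v T) : ∃ t : Fin r → ℤ, HasDefectsG c v T t := by
  have h1R : (1 : PermsG n) ∈ R := one_mem_of_closed hmul hinv hne
  -- the units
  let U : Fin r → Fin r := fun m => if m = m₂ then m₁ else m
  have hU₁ : U m₁ = m₁ := by simp only [U]; split_ifs <;> rfl
  have hU₂ : U m₂ = m₁ := by simp only [U, if_pos rfl]
  have hUo : ∀ m, m ≠ m₁ → m ≠ m₂ → U m = m := fun m _ h₂ => by simp only [U, if_neg h₂]
  have hUfib : ∀ m m₀, m₀ ≠ m₁ → m₀ ≠ m₂ → (U m = U m₀ ↔ m = m₀) := by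
    intro m m₀ h₁ h₂
    rw [hUo m₀ h₁ h₂]
    constructor
    · intro h
      by_cases hm2 : m = m₂
      · rw [hm2, hU₂] at h; exact absurd h.symm h₁
      · by_cases hm1 : m = m₁
        · rw [hm1, hU₁] at h; exact absurd h.symm h₁
        · rwa [hUo m hm1 hm2] at h
    · rintro rfl; exact hUo m h₁ h₂
  -- the unit-wise product `R'`
  set R' : Finset (PermsG n) := Finset.univ.filter fun π' => ∀ m₀, ∃ π ∈ R, ∀ m, U m = U m₀ → π m = π' m with hR'
  have hmemR' : ∀ π' : PermsG n, π' ∈ R' ↔ ∀ m₀, ∃ π ∈ R, ∀ m, U m = U m₀ → π m = π' m := fun π' => by simp [hR']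
  have hRR' : R ⊆ R' := fun π hπ => (hmemR' π).2 fun m₀ => ⟨π, hπ, fun _ _ => rfl⟩
  have hmul' : ∀ π ∈ R', ∀ π' ∈ R', π * π' ∈ R' := by
    intro π₁ h₁ π₂ h₂
    rw [hmemR'] at h₁ h₂ ⊢
    intro m₀
    obtain ⟨ρ₁, hρ₁, e₁⟩ := h₁ m₀
    obtain ⟨ρ₂, hρ₂, e₂⟩ := h₂ m₀
    exact ⟨ρ₁ * ρ₂, hmul _ hρ₁ _ hρ₂, fun m hm => by rw [Pi.mul_apply, Pi.mul_apply, e₁ m hm, e₂ m hm]⟩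
  have hinv' : ∀ π ∈ R', π⁻¹ ∈ R' := by
    intro π₁ h₁
    rw [hmemR'] at h₁ ⊢
    intro m₀
    obtain ⟨ρ, hρ, e⟩ := h₁ m₀
    exact ⟨ρ⁻¹, hinv _ hρ, fun m hm => by rw [Pi.inv_apply, Pi.inv_apply, e m hm]⟩
  have hne' : R'.Nonempty := hne.mono hRR'
  have htrans' : ∀ (m : Fin r) (a a' : Fin (n m)), ∃ π ∈ R', π m a = a' := fun m a a' => by
    obtain ⟨π, hπ, h⟩ := htrans m a a'
    exact ⟨π, hRR' hπ, h⟩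
  -- the defects and the signed equations at `R`, transferred to `R'`
  set d : ∀ m : Fin r, Fin (n m) → ℤ := fun m a => ((cnt v T (Sum.inr ⟨m, (a, true)⟩)) : ℤ) - cnt v T (Sum.inr ⟨m, (a, false)⟩) with hd
  have hsig : ∀ π ∈ R', (((cnt v T (Sum.inl true)) : ℤ) - cnt v T (Sum.inl false)) +
      ∑ m : Fin r, ∑ a : Fin (n m), (if π m a ∈ P m then d m a else -d m a) = 0 := fun π' hπ' =>
    signed_transfer_units (d := d) U hmul hne htrans (fun m₀ m hmm a a' => hstab m₀ m hmm a a') (fun π hπ => signed_of_modelBalancedG R v hT hπ) π'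
      ((hmemR' π').1 hπ')
  -- every NON-TWIN slot is moved ALONE, inside `R'`, by a tuple of prime order
  have hpure : ∀ m₀ : Fin r, m₀ ∉ ({m₁, m₂} : Finset (Fin r)) → ∃ ρ ∈ R', (∀ m ∈ ({m₁, m₂} : Finset (Fin r)), ρ m = 1) ∧
      (∀ m, m ∉ ({m₁, m₂} : Finset (Fin r)) → (m : ℕ) < (m₀ : ℕ) → ρ m = 1) ∧ orderOf (ρ m₀) = n m₀ := by
    intro m₀ hm₀
    have hm₀₁ : m₀ ≠ m₁ := fun h => hm₀ (by rw [h, Finset.mem_insert]; exact Or.inl rfl)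
    have hm₀₂ : m₀ ≠ m₂ := fun h => hm₀ (by rw [h, Finset.mem_insert, Finset.mem_singleton]; exact Or.inr rfl)
    have h2 : 2 ≤ n m₀ := (hpr m₀).two_le
    obtain ⟨π₁, hπ₁, hmove⟩ := htrans m₀ ⟨0, by omega⟩ ⟨1, by omega⟩
    have hσ : π₁ m₀ ≠ 1 := fun h => by
      have := hmove
      rw [h, Equiv.Perm.one_apply] at this
      exact absurd (congrArg Fin.val this) (by simp)
    have hex : ∃ π ∈ R', (∀ m ∈ Finset.univ.erase m₀, π m = 1) ∧ π m₀ ≠ 1 := by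
      refine ⟨Function.update (1 : PermsG n) m₀ (π₁ m₀), (hmemR' _).2 fun m' => ?_, fun m hm' => ?_, ?_⟩
      · by_cases hm' : U m' = U m₀
        · refine ⟨π₁, hπ₁, fun m hmm => ?_⟩
          have hmm' : m = m₀ := (hUfib m m₀ hm₀₁ hm₀₂).1 (hmm.trans hm')
          subst hmm'
          rw [Function.update_self]
        · refine ⟨1, h1R, fun m hmm => ?_⟩
          have hmm' : m ≠ m₀ := fun h => hm' (by rw [← h, hmm])
          rw [Function.update_of_ne hmm', Pi.one_apply]
      · rw [Function.update_of_ne (Finset.ne_of_mem_erase hm'), Pi.one_apply]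
      · rw [Function.update_self]
        exact hσ
    obtain ⟨ρ, hρ, hρS, hord⟩ := exists_orderOf_eq_of_trivial_on hmul' hinv' hne' (hpr m₀) (htrans' m₀) (Finset.univ.erase m₀) hex
    exact ⟨ρ, hρ, fun m hm => hρS m (Finset.mem_erase.2 ⟨fun h => hm₀ (h ▸ hm), Finset.mem_univ m⟩),
      fun m _ hlt => hρS m (Finset.mem_erase.2 ⟨fun h => by rw [h] at hlt; exact lt_irrefl _ hlt, Finset.mem_univ m⟩), hord⟩
  -- the prime tower with the twin pair excluded: the non-twin defects are constant
  have hconst := const_of_signed_primeTower (P := P) hmul' hne' ({m₁, m₂} : Finset (Fin r)) (fun m => (m : ℕ)) (fun m _ => hpr m)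
    (fun m m' _ _ h => Fin.ext h) (fun m _ => hP0 m) (fun m _ => hPn m) hpure hsig
  -- the twin unit: on `R'` the twin sums are constant
  have hother : ∀ π ∈ R', ∀ m, m ≠ m₁ → m ≠ m₂ →
      (∑ a : Fin (n m), (if π m a ∈ P m then d m a else -d m a)) = ∑ a : Fin (n m), (if (1 : PermsG n) m a ∈ P m then d m a else -d m a) := by
    intro π _ m h₁ h₂
    have hmn : m ∉ ({m₁, m₂} : Finset (Fin r)) := by rw [Finset.mem_insert, Finset.mem_singleton, not_or]; exact ⟨h₁, h₂⟩
    have hcm := hconst m hmn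
    have h0 : 0 < n m := (hpr m).pos
    rw [Finset.sum_congr rfl fun a _ => by rw [hcm a ⟨0, h0⟩], sum_ite_mem_const, Finset.sum_congr rfl fun a _ => by rw [hcm a ⟨0, h0⟩], sum_ite_mem_const]
  have htwin := const_of_signed_twin (P := P) (D := R') hn h3 hP₁ hP₂ hp
    (fun π' hπ' a => by
      obtain ⟨π, hπ, hπe⟩ := (hmemR' π').1 hπ' m₁
      rw [← hπe m₁ rfl, ← hπe m₂ (hU₂.trans hU₁.symm)]
      exact hdiag π hπ a)
    (fun a a' b b' haa hbb => by
      obtain ⟨π, hπ, h⟩ := h2t a a' b b' haa hbb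
      exact ⟨π, hRR' hπ, h⟩)
    (d := d) (w := -((((cnt v T (Sum.inl true)) : ℤ) - cnt v T (Sum.inl false)) +
      ∑ m ∈ (Finset.univ.erase m₁).erase m₂, ∑ a : Fin (n m), (if (1 : PermsG n) m a ∈ P m then d m a else -d m a)))
    (fun π hπ => by
      have hs := hsig π hπ
      rw [← Finset.add_sum_erase _ _ (Finset.mem_univ m₁), ← Finset.add_sum_erase _ _ (Finset.mem_erase.2 ⟨hm.symm, Finset.mem_univ m₂⟩)] at hs
      rw [Finset.sum_congr rfl fun m hm' => hother π hπ m (Finset.ne_of_mem_erase (Finset.mem_of_mem_erase hm')) (Finset.ne_of_mem_erase hm')] at hs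
      linarith)
  -- all defects are constant
  have hall : ∀ (m : Fin r) (a b : Fin (n m)), d m a = d m b := by
    intro m
    by_cases h₁ : m = m₁
    · subst h₁; exact htwin.1
    · by_cases h₂ : m = m₂
      · subst h₂; exact htwin.2
      · exact hconst m (by rw [Finset.mem_insert, Finset.mem_singleton, not_or]; exact ⟨h₁, h₂⟩)
  obtain ⟨t, hdt, he⟩ := exists_defects_of_const (P := P) hne' hall hsig
  refine ⟨t, fun m a => hdt m a, ?_⟩
  rw [he]
  exact Finset.sum_congr rfl fun m _ => by rw [hc m]

end Model


end Summit.HodgeConjecture.CorCM.MultiFieldWeil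

end
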